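import Summits.BirchSwinnertonDyer.BirchSwinnertonDyer.Theorems.GenusKolyvaginAtTwoGenusPrimitiveSupplyAtTwoPrimeTwistModel
import Summits.BirchSwinnertonDyer.BirchSwinnertonDyer.Theorems.GenusKolyvaginAtTwoGenusPrimitiveSupplyAtTwoPrimeTwistLattice
import Summits.BirchSwinnertonDyer.BirchSwinnertonDyer.Theorems.GenusKolyvaginAtTwoGenusPrimitiveSupplyAtTwoArchimedeanRowsHold
import Literature.NumberTheory.EllipticCurves.SelmerProofs
import HarnessLib

/-!
# Route `GenusKolyvaginAtTwo`, crux #2 `GenusPrimitiveSupplyAtTwo` (stmt-BirchSwinnertonDyer-22136):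
# THE MODEL ↔ `PrimeTwist` DICTIONARY at `p = 2`, GLOBAL CONSEQUENCES — `Sel₂(Wd/K) ≅ Sel_𝔓(A_χ/K)`, `Ш(Wd/K) ≅ Ш(A_χ/K)`,
# `#Sel_𝔓(A_χ/ℚ) = #Sel₂(W^{(d)}/ℚ)` and the θ-bit: **`F1Sign2.TwistModelDictionaryAtTwo` BY NAME**; **U′ `F1Sign2.OddBranchShaIndexTwoInTwistSelmerAtTwo`
# BY NAME**; and the UP DECISION off the egg in prime-twist currency (Kramer's parity transported): `Sel₂(W)` strict at `∞` ⟹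
# `Sel_𝔓(A_χ) = Sel₂^{rel ∞}(W)`, `#Sel_𝔓(A_χ) = 2·#Sel₂(W)`

Width seat `bsd-line-gk2-p5` g15 (cell `bsd-f1-sign2`, SUPPLY lineage of crux 22136), file 40 of the series; sequel of file 39 `…PrimeTwistModel`
(the equivariant `Φ : Wd(K̄) ≃+ A_χ(K̄)` and the local transport at every `K`-field), file 38 `…PrimeTwistLattice` (the hypothesis-free `Δ > 0`
lattice) and `…ArchimedeanRowsHold` (T-A `admissibleTwistSelmerShiftAtTwo_holds`, model currency). THEOREMS ONLY (no definition, no named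
fact, no `sorry`); helper `--supports stmt-BirchSwinnertonDyer-22136`; no item is closed; BSD is not proved by any of this.

WHAT.
* §177 (any number field `K`, `2 ≠ 0` automatic) `exists_primeTwistModel_selmerGroup_sha_iff` — under the pair `(ψ, Φ)` of file 39,
  `x ∈ Sel₂(Wd/K) ↔ h1Equiv ψ x ∈ Sel_𝔓(A_χ/K)` and `c ∈ Ш(Wd/K) ↔ h1Equiv Φ c ∈ Ш(A_χ/K)`; hence `nonempty_selmerGroup_addEquiv_primeTwist_selmerGroup`,
  `nonempty_sha_addEquiv_primeTwist_sha`, `natCard_primeTwist_selmerGroup_eq_natCard_selmerGroup_model`.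
* §178 (over `ℚ`, `χ` with `F1Sign2.IsQuadraticCharacterOf χ d`, `d ≠ 0`): `smul_geomSqrt_iff_of_isQuadraticCharacterOf`;
  **`natCard_primeTwist_selmerGroup_eq_twistSelmerTwoCard`** `#Sel_𝔓(A_χ/ℚ) = twistSelmerTwoCard W d`; the two `Nonempty (≃+)` clauses
  (1)–(2) of `F1Sign2.TwistModelDictionaryAtTwo` (`twistModelDictionaryAtTwo_selmer`, `twistModelDictionaryAtTwo_sha`).
* §181 `shaTwoInTwiceShaFour_iff_not_twistCasselsTateOddAtTwo` — clause (3), the Cassels–Tate parity bit `θ`, for any model (the `H¹` square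
  `h1Equiv Φ ∘ (H¹(ℚ, Wd[2]) → H¹(ℚ, Wd)) = twistShaMapAtTwo ∘ h1Equiv ψ` + the tree's `Sel₂ ↠ Ш[2]` `map_torsionH1ToH1_selmerGroup_holds`);
  **`twistModelDictionaryAtTwo_holds : F1Sign2.TwistModelDictionaryAtTwo`** — the row BY NAME, all three clauses, every `W`, every square-free `d`.
* §179 **`oddBranchShaIndexTwoInTwistSelmerAtTwo_holds : F1Sign2.OddBranchShaIndexTwoInTwistSelmerAtTwo`** — U′ (DESC-§17-U′) BY NAME,
  unconditional: on the odd branch `#Sel_𝔓(A_χ) = #Sel₂(W^{(d)}) = 8 = 2·#Sel₂(W)` (dictionary), so `Sel_𝔓(A_χ) = Sel₂^{rel ∞}(W)` (DESC-§17-R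
  `twistSelmerEqRelaxedAtInfinityAtTwo_holds`) of index `8/4 = 2` over `Sel₂(W)` (`F1Sign2.shaIndexTwo_of_relaxed`).
* §180 **the UP decision** `primeTwist_selmerGroup_eq_relaxed_of_forall_localization_eq_zero`: `Δ_W > 0`, `E(ℚ)[2] = 0`, `d` descent-admissible,
  every `Sel₂(W)`-class trivial at `∞` ⟹ `Sel_𝔓(A_χ) = Sel₂^{rel ∞}(W)` and `#Sel_𝔓(A_χ) = 2·#Sel₂(W)` (T-A in model currency + the dictionary
  + file 38's dichotomy); with file 38's «Selmer egg bit 1 ⟹ DOWN» this completes the prime-twist Selmer law by the `∞`-bit of `Sel₂(W)`: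
  `natCard_primeTwist_selmerGroup_eq_of_infinity_bit`.

Honest framing: KNOWN in print (Mazur–Rubin 2007 §3 / Prop. 4.1 / Def. 4.3: `A_χ = E^{(d)}` for `p = 2`; Kramer 1981 Thm. 1 / Prop. 7;
Mazur–Rubin 2010 Lemma 3.2 / Prop. 3.3); kernel-new bookkeeping; beyond-print theorem: no. Crux 22136 stays OPEN exactly at (U) 24947 ∧
(CONV₂) 19220/24948. BSD is not proved by any of this.

References: [MazurRubin2007] §3, Prop. 4.1, Def. 4.3; [MazurRubin2010] Def. 3.1, Lemma 3.2, Prop. 3.3; [Kramer1981] Thm. 1, Prop. 6, Prop. 7;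
[SilvermanAEC2009] X.5 Cor. 5.4.
-/

set_option linter.dupNamespace false -- tree convention: `Summit.BirchSwinnertonDyer.BirchSwinnertonDyer.Theorems` (summit = sub-problem)
set_option autoImplicit false

noncomputable section

open scoped Classical

namespace Summit.BirchSwinnertonDyer.BirchSwinnertonDyer.Theorems.GenusKolyArch

open WeierstrassCurve Field NumberField
open Literature.NumberTheory.EllipticCurves Literature.NumberTheory.GaloisRepresentations
open Summit.BirchSwinnertonDyer.Rank1Residual.F1Sign2

universe u
/-! ## §177 Over a number field: `Sel₂(Wd/K) ≅ Sel_𝔓(A_χ/K)` and `Ш(Wd/K) ≅ Ш(A_χ/K)` -/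

section NumberField

open NumberField IsDedekindDomain

variable {K : Type u} [Field K] [NumberField K] [NeZero (2 : K)]

/-- **`Sel₂(Wd/K) ↔ Sel_𝔓(A_χ/K)` and `Ш(Wd/K) ↔ Ш(A_χ/K)` under the dictionary** (`K` a number field, `Wd` ANY model of `E^{(d)}`, `χ` the
character of `K(√d)`): the local conditions correspond at every finite and every infinite place (§176). [cite: MazurRubin2007, §3, Prop 4.1 and Def 4.3] -/
theorem exists_primeTwistModel_selmerGroup_sha_iff (W : WeierstrassCurve K) {d : K} (hd : d ≠ 0)
    {Wd : WeierstrassCurve K} {C : VariableChange K} (hWd : C • W.quadraticTwist d = Wd)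
    (χ : absoluteGaloisGroup K →ₜ* Multiplicative (ZMod 2))
    (hχ : ∀ σ : absoluteGaloisGroup K, χ σ = 1 ↔ σ • geomSqrt d = geomSqrt d) :
    ∃ (ψ : geomTorsion Wd ((2 : ℕ) : ℤ) ≃+ geomTorsion W ((2 : ℕ) : ℤ))
      (hψ : ∀ (g : absoluteGaloisGroup K) (t : geomTorsion Wd ((2 : ℕ) : ℤ)), ψ (g • t) = g • ψ t)
      (Φ : geomPoints Wd ≃+ PrimeTwist.geomModule W χ)
      (hΦ : ∀ (g : absoluteGaloisGroup K) (P : geomPoints Wd), Φ (g • P) = g • Φ P),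
      (∀ t : geomTorsion Wd ((2 : ℕ) : ℤ), Φ (t : geomPoints Wd) =
          PrimeTwist.constEmb (χ : absoluteGaloisGroup K →* Multiplicative (ZMod 2)) W.geomPoints (ψ t)) ∧
      (∀ x : Wd.galH1Torsion ((2 : ℕ) : ℤ),
          x ∈ Wd.selmerGroup ((2 : ℕ) : ℤ) ↔ h1Equiv ψ hψ x ∈ PrimeTwist.selmerGroup W χ) ∧
      (∀ c : Wd.galH1, c ∈ Wd.sha ↔ h1Equiv Φ hΦ c ∈ PrimeTwist.sha W χ) := by
  obtain ⟨ψ, hψ, Φ, hΦ, htors, hloc⟩ := exists_primeTwistModel_dictionary W hd hWd χ hχ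
  refine ⟨ψ, hψ, Φ, hΦ, htors, fun x ↦ ?_, fun c ↦ ?_⟩
  · rw [WeierstrassCurve.mem_selmerGroup_iff, PrimeTwist.mem_selmerGroup_iff]
    exact and_congr (forall_congr' fun v ↦ (hloc (v.adicCompletion K)).1 x)
      (forall_congr' fun w ↦ (hloc w.Completion).1 x)
  · rw [WeierstrassCurve.mem_sha_iff, PrimeTwist.mem_sha_iff]
    exact and_congr (forall_congr' fun v ↦ (hloc (v.adicCompletion K)).2 c)
      (forall_congr' fun w ↦ (hloc w.Completion).2 c)

/-- Two subgroups corresponding under an additive isomorphism of the ambient groups are isomorphic. [folklore] -/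
theorem nonempty_addEquiv_of_forall_mem_iff {G G' : Type*} [AddGroup G] [AddGroup G'] (e : G ≃+ G') (A : AddSubgroup G)
    (B : AddSubgroup G') (h : ∀ x, x ∈ A ↔ e x ∈ B) : Nonempty (A ≃+ B) :=
  ⟨{ toFun := fun a ↦ ⟨e a, (h a).mp a.2⟩
     invFun := fun b ↦ ⟨e.symm b, (h _).mpr (by rw [AddEquiv.apply_symm_apply]; exact b.2)⟩
     left_inv := fun a ↦ Subtype.ext (e.symm_apply_apply a)
     right_inv := fun b ↦ Subtype.ext (e.apply_symm_apply b)
     map_add' := fun a b ↦ Subtype.ext (map_add e (a : G) (b : G)) }⟩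

/-- **`Sel₂(Wd/K) ≅ Sel_𝔓(A_χ/K)`** for any model `Wd` of `E^{(d)}` over a number field (`TwistModelDictionaryAtTwo` (1), general form).
[cite: MazurRubin2007, §3, Prop 4.1 and Def 4.3] -/
theorem nonempty_selmerGroup_addEquiv_primeTwist_selmerGroup (W : WeierstrassCurve K) {d : K} (hd : d ≠ 0)
    {Wd : WeierstrassCurve K} {C : VariableChange K} (hWd : C • W.quadraticTwist d = Wd)
    (χ : absoluteGaloisGroup K →ₜ* Multiplicative (ZMod 2))
    (hχ : ∀ σ : absoluteGaloisGroup K, χ σ = 1 ↔ σ • geomSqrt d = geomSqrt d) :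
    Nonempty (↥(Wd.selmerGroup ((2 : ℕ) : ℤ)) ≃+ ↥(PrimeTwist.selmerGroup W χ)) := by
  obtain ⟨ψ, hψ, Φ, hΦ, -, hSel, -⟩ := exists_primeTwistModel_selmerGroup_sha_iff W hd hWd χ hχ
  exact nonempty_addEquiv_of_forall_mem_iff (h1Equiv ψ hψ) _ _ hSel

/-- **`Ш(Wd/K) ≅ Ш(A_χ/K)`** for any model `Wd` of `E^{(d)}` over a number field (`TwistModelDictionaryAtTwo` (2), general form).
[cite: MazurRubin2007, §3 and §2] -/
theorem nonempty_sha_addEquiv_primeTwist_sha (W : WeierstrassCurve K) {d : K} (hd : d ≠ 0)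
    {Wd : WeierstrassCurve K} {C : VariableChange K} (hWd : C • W.quadraticTwist d = Wd)
    (χ : absoluteGaloisGroup K →ₜ* Multiplicative (ZMod 2))
    (hχ : ∀ σ : absoluteGaloisGroup K, χ σ = 1 ↔ σ • geomSqrt d = geomSqrt d) :
    Nonempty (↥(Wd.sha) ≃+ ↥(PrimeTwist.sha W χ)) := by
  obtain ⟨ψ, hψ, Φ, hΦ, -, -, hSha⟩ := exists_primeTwistModel_selmerGroup_sha_iff W hd hWd χ hχ
  exact nonempty_addEquiv_of_forall_mem_iff (h1Equiv Φ hΦ) _ _ hSha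

/-- **`#Sel_𝔓(A_χ/K) = #Sel₂(Wd/K)`** for any model `Wd` of `E^{(d)}` over a number field. [cite: MazurRubin2007, §3, Prop 4.1 and Def 4.3] -/
theorem natCard_primeTwist_selmerGroup_eq_natCard_selmerGroup_model (W : WeierstrassCurve K) {d : K} (hd : d ≠ 0)
    {Wd : WeierstrassCurve K} {C : VariableChange K} (hWd : C • W.quadraticTwist d = Wd)
    (χ : absoluteGaloisGroup K →ₜ* Multiplicative (ZMod 2))
    (hχ : ∀ σ : absoluteGaloisGroup K, χ σ = 1 ↔ σ • geomSqrt d = geomSqrt d) :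
    Nat.card (PrimeTwist.selmerGroup W χ) = Nat.card (Wd.selmerGroup ((2 : ℕ) : ℤ)) := by
  obtain ⟨e⟩ := nonempty_selmerGroup_addEquiv_primeTwist_selmerGroup W hd hWd χ hχ
  exact (Nat.card_congr e.toEquiv).symm

end NumberField

/-! ## §178 Over `ℚ`: the character of `ℚ(√d)`, `#Sel_𝔓(A_χ) = #Sel₂(W^{(d)})`, `TwistModelDictionaryAtTwo` (1)–(2) -/

section Rat

variable (W : WeierstrassCurve ℚ) {d : ℤ} {χ : absoluteGaloisGroup ℚ →ₜ* Multiplicative (ZMod 2)}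

/-- `IsQuadraticCharacterOf χ d` in the form file 39 consumes: `χ σ = 1 ↔ σ√d = √d` for the tree's `√d = geomSqrt (d : ℚ)`. [folklore] -/
theorem smul_geomSqrt_iff_of_isQuadraticCharacterOf (hχ : IsQuadraticCharacterOf χ d) (σ : absoluteGaloisGroup ℚ) :
    χ σ = 1 ↔ σ • geomSqrt (d : ℚ) = geomSqrt (d : ℚ) := by
  have hr : (geomSqrt (d : ℚ)) ^ 2 = ((d : ℚ) : AlgebraicClosure ℚ) := by
    rw [geomSqrt_sq, eq_ratCast]
  exact hχ _ hr σ

/-- **`#Sel_𝔓(A_χ/ℚ) = #Sel₂(Wd/ℚ)` for ANY model `Wd = C • W^{(d)}`** (`d ≠ 0`, `χ` the character of `ℚ(√d)`). [cite: MazurRubin2007, §3, Prop 4.1 and Def 4.3] -/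
theorem natCard_primeTwist_selmerGroup_eq_natCard_selmerGroup_rat (hd : d ≠ 0) (hχ : IsQuadraticCharacterOf χ d)
    {Wd : WeierstrassCurve ℚ} {C : VariableChange ℚ} (hWd : C • W.quadraticTwist (d : ℚ) = Wd) :
    Nat.card (PrimeTwist.selmerGroup W χ) = Nat.card (Wd.selmerGroup ((2 : ℕ) : ℤ)) :=
  natCard_primeTwist_selmerGroup_eq_natCard_selmerGroup_model W (Int.cast_ne_zero.mpr hd) hWd χ
    (smul_geomSqrt_iff_of_isQuadraticCharacterOf hχ)

/-- **`#Sel_𝔓(A_χ/ℚ) = twistSelmerTwoCard W d = #Sel₂(W^{(d)}/ℚ)`** — the count U′ / T-2q / the `-desc` rows pull through the dictionary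
(`d ≠ 0`, `χ` the character of `ℚ(√d)`; no other hypothesis). [cite: MazurRubin2007, §3, Prop 4.1 and Def 4.3] -/
theorem natCard_primeTwist_selmerGroup_eq_twistSelmerTwoCard (hd : d ≠ 0) (hχ : IsQuadraticCharacterOf χ d) :
    Nat.card (PrimeTwist.selmerGroup W χ) = twistSelmerTwoCard W d :=
  natCard_primeTwist_selmerGroup_eq_natCard_selmerGroup_rat W hd hχ (one_smul _ _)

/-- **`TwistModelDictionaryAtTwo` (1): `Sel₂(W^{(d)}/ℚ) ≅ Sel_𝔓(A_χ/ℚ)`** (`d ≠ 0`). [cite: MazurRubin2007, §3, Prop 4.1 and Def 4.3] -/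
theorem twistModelDictionaryAtTwo_selmer (hd : d ≠ 0) (hχ : IsQuadraticCharacterOf χ d) :
    Nonempty (↥(WeierstrassCurve.selmerGroup (W.quadraticTwist (d : ℚ)) ((2 : ℕ) : ℤ)) ≃+ ↥(PrimeTwist.selmerGroup W χ)) :=
  nonempty_selmerGroup_addEquiv_primeTwist_selmerGroup W (Int.cast_ne_zero.mpr hd) (one_smul _ _) χ
    (smul_geomSqrt_iff_of_isQuadraticCharacterOf hχ)

/-- **`TwistModelDictionaryAtTwo` (2): `Ш(W^{(d)}/ℚ) ≅ Ш(A_χ/ℚ)`** (`d ≠ 0`). [cite: MazurRubin2007, §3 and §2] -/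
theorem twistModelDictionaryAtTwo_sha (hd : d ≠ 0) (hχ : IsQuadraticCharacterOf χ d) :
    Nonempty (↥(WeierstrassCurve.sha (W.quadraticTwist (d : ℚ))) ≃+ ↥(PrimeTwist.sha W χ)) :=
  nonempty_sha_addEquiv_primeTwist_sha W (Int.cast_ne_zero.mpr hd) (one_smul _ _) χ
    (smul_geomSqrt_iff_of_isQuadraticCharacterOf hχ)

/-- The same two clauses under `TwistModelDictionaryAtTwo`'s own binders (`Squarefree d`; `¬ IsSquare d` and `IsElliptic` unused): the first
two conjuncts of `F1Sign2.TwistModelDictionaryAtTwo` hold for every `W`. [cite: MazurRubin2007, §3, Prop 4.1 and Def 4.3] -/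
theorem twistModelDictionaryAtTwo_selmer_sha (W : WeierstrassCurve ℚ) (d : ℤ)
    (χ : absoluteGaloisGroup ℚ →ₜ* Multiplicative (ZMod 2)) (hsf : Squarefree d) (hχ : IsQuadraticCharacterOf χ d) :
    Nonempty (↥(WeierstrassCurve.selmerGroup (W.quadraticTwist (d : ℚ)) ((2 : ℕ) : ℤ)) ≃+ ↥(PrimeTwist.selmerGroup W χ)) ∧
      Nonempty (↥(WeierstrassCurve.sha (W.quadraticTwist (d : ℚ))) ≃+ ↥(PrimeTwist.sha W χ)) :=
  ⟨twistModelDictionaryAtTwo_selmer W hsf.ne_zero hχ, twistModelDictionaryAtTwo_sha W hsf.ne_zero hχ⟩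

end Rat

/-! ## §181 `TwistModelDictionaryAtTwo` (3) — the Cassels–Tate parity bit — and the row BY NAME -/

section Bit

variable (W : WeierstrassCurve ℚ) {d : ℤ} {χ : absoluteGaloisGroup ℚ →ₜ* Multiplicative (ZMod 2)}

/-- **`TwistModelDictionaryAtTwo` (3) for ANY model: `θ(Wd) = +` (`Ш(Wd)[2] ⊆ 2·Ш(Wd)[4]`) iff the twist's Cassels–Tate form is not odd
(`¬ TwistCasselsTateOddAtTwo W χ`: every `𝔓`-Selmer class maps to twice a `4`-torsion class of `Ш(A_χ)`).** Transport along the pair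
`(ψ, Φ)` of file 39: the square `h1Equiv Φ ∘ (H¹(ℚ, Wd[2]) → H¹(ℚ, Wd)) = twistShaMapAtTwo ∘ h1Equiv ψ` is functoriality plus
`Φ|_{Wd[2]} = constEmb ∘ ψ`, and `Sel₂(Wd) ↠ Ш(Wd)[2]` is the tree's `map_torsionH1ToH1_selmerGroup_holds` (Silverman X.4.2(a)).
[cite: MazurRubin2007, §3, Prop 4.1 and Def 4.3] [cite: SilvermanAEC2009, Thm X.4.2(a)] -/
theorem shaTwoInTwiceShaFour_iff_not_twistCasselsTateOddAtTwo (hd : d ≠ 0) (hχ : IsQuadraticCharacterOf χ d)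
    {Wd : WeierstrassCurve ℚ} {C : VariableChange ℚ} (hWd : C • W.quadraticTwist (d : ℚ) = Wd) :
    ShaTwoInTwiceShaFour Wd ↔ ¬ TwistCasselsTateOddAtTwo W χ := by
  obtain ⟨ψ, hψ, Φ, hΦ, htors, hSel, hSha⟩ := exists_primeTwistModel_selmerGroup_sha_iff W (Int.cast_ne_zero.mpr hd) hWd χ
    (smul_geomSqrt_iff_of_isQuadraticCharacterOf hχ)
  set χ' : absoluteGaloisGroup ℚ →* Multiplicative (ZMod 2) := (χ : absoluteGaloisGroup ℚ →* Multiplicative (ZMod 2)) with hχ'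
  -- the square on `H¹`: functoriality + `Φ|_{Wd[2]} = constEmb ∘ ψ`
  have hsq : ∀ x : Wd.galH1Torsion ((2 : ℕ) : ℤ),
      h1Equiv Φ hΦ (Wd.torsionH1ToH1 ((2 : ℕ) : ℤ) x) = twistShaMapAtTwo W χ (h1Equiv ψ hψ x) := by
    intro x
    change resH1Hom (ContinuousMonoidHom.id _) (Φ : geomPoints Wd →+ PrimeTwist.geomModule W χ) hΦ
        (resH1Hom (ContinuousMonoidHom.id _) (geomTorsion Wd ((2 : ℕ) : ℤ)).subtype (fun _ _ ↦ rfl) x) =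
      resH1Hom (ContinuousMonoidHom.id _) (PrimeTwist.constEmb χ' W.geomPoints) (fun _ _ ↦ rfl)
        (resH1Hom (ContinuousMonoidHom.id _) (ψ : geomTorsion Wd ((2 : ℕ) : ℤ) →+ geomTorsion W ((2 : ℕ) : ℤ)) hψ x)
    rw [resH1Hom_resH1Hom, resH1Hom_resH1Hom]
    exact DFunLike.congr_fun (resH1Hom_congr rfl (AddMonoidHom.ext fun t ↦ htors t) _ _) x
  -- `Sel₂(Wd) ↠ Ш(Wd)[2]`
  have himg : (Wd.selmerGroup ((2 : ℕ) : ℤ)).map (Wd.torsionH1ToH1 ((2 : ℕ) : ℤ)) =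
      Wd.sha ⊓ AddSubgroup.torsionBy Wd.galH1 ((2 : ℕ) : ℤ) :=
    Wd.map_torsionH1ToH1_selmerGroup_holds (by norm_num)
  have hmem2 : ∀ c : Wd.galH1, c ∈ AddSubgroup.torsionBy Wd.galH1 ((2 : ℕ) : ℤ) ↔ (2 : ℕ) • c = 0 := fun c ↦ by
    change ((2 : ℕ) : ℤ) • c = 0 ↔ (2 : ℕ) • c = 0
    rw [natCast_zsmul]
  constructor
  · rintro hθ ⟨x, hx, hnot⟩
    apply hnot
    refine ⟨hx, ?_⟩
    have hxx : h1Equiv ψ hψ ((h1Equiv ψ hψ).symm x) = x := (h1Equiv ψ hψ).apply_symm_apply x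
    have hxS : (h1Equiv ψ hψ).symm x ∈ Wd.selmerGroup ((2 : ℕ) : ℤ) := (hSel _).mpr (hxx.symm ▸ hx)
    have hy : Wd.torsionH1ToH1 ((2 : ℕ) : ℤ) ((h1Equiv ψ hψ).symm x) ∈ Wd.sha ⊓ AddSubgroup.torsionBy Wd.galH1 ((2 : ℕ) : ℤ) := by
      rw [← himg]
      exact AddSubgroup.mem_map_of_mem _ hxS
    obtain ⟨hysha, hytor⟩ := AddSubgroup.mem_inf.mp hy
    obtain ⟨c', hc'sha, hc'4, hc'2⟩ := hθ _ hysha ((hmem2 _).mp hytor)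
    refine ⟨h1Equiv Φ hΦ c', (hSha c').mp hc'sha, by rw [← map_nsmul, hc'4, map_zero], ?_⟩
    rw [← map_nsmul, hc'2, hsq, hxx]
  · intro hne c' hc'sha hc'2
    have hc'mem : c' ∈ (Wd.selmerGroup ((2 : ℕ) : ℤ)).map (Wd.torsionH1ToH1 ((2 : ℕ) : ℤ)) := by
      rw [himg]
      exact AddSubgroup.mem_inf.mpr ⟨hc'sha, (hmem2 _).mpr hc'2⟩
    obtain ⟨x', hx'S, hx'c⟩ := AddSubgroup.mem_map.mp hc'mem
    have hrad : InTwistCasselsTateRadicalAtTwo W χ (h1Equiv ψ hψ x') := by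
      by_contra h
      exact hne ⟨_, (hSel x').mp hx'S, h⟩
    obtain ⟨-, c₁, hc₁sha, hc₁4, hc₁2⟩ := hrad
    refine ⟨(h1Equiv Φ hΦ).symm c₁, (hSha _).mpr (by rw [AddEquiv.apply_symm_apply]; exact hc₁sha), ?_, ?_⟩
    · apply (h1Equiv Φ hΦ).injective
      rw [map_nsmul, AddEquiv.apply_symm_apply, hc₁4, map_zero]
    · apply (h1Equiv Φ hΦ).injective
      rw [map_nsmul, AddEquiv.apply_symm_apply, hc₁2, ← hx'c, hsq]

/-- **`F1Sign2.TwistModelDictionaryAtTwo` HOLDS (REF1 §41 / DESC-§17-DICT) — the MODEL ↔ `PrimeTwist` dictionary at `p = 2` BY NAME, for every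
`W/ℚ`, every square-free `d` and its quadratic character `χ`:** (1) `Sel₂(W^{(d)}) ≅ Sel_𝔓(A_χ)`, (2) `Ш(W^{(d)}) ≅ Ш(A_χ)`, (3) `θ(W^{(d)}) = +`
iff the twist's Cassels–Tate form is not odd. (`IsElliptic` and `¬ IsSquare d` are not used.) Mazur–Rubin 2007 §3: «for `p = 2`, `A_L` is the
quadratic twist of `E` by `L/K`» — formalised; kernel-new; BSD is not proved by this. [cite: MazurRubin2007, §3, Prop 4.1 and Def 4.3]
[cite: SilvermanAEC2009, X.5 Cor. 5.4, Thm X.4.2(a)] -/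
theorem twistModelDictionaryAtTwo_holds : TwistModelDictionaryAtTwo := by
  intro W _ d χ hsf _ hχ
  exact ⟨twistModelDictionaryAtTwo_selmer W hsf.ne_zero hχ, twistModelDictionaryAtTwo_sha W hsf.ne_zero hχ,
    shaTwoInTwiceShaFour_iff_not_twistCasselsTateOddAtTwo W hsf.ne_zero hχ (one_smul _ _)⟩

end Bit

/-! ## §179 U′ `OddBranchShaIndexTwoInTwistSelmerAtTwo` BY NAME -/

/-- **U′ (DESC-§17-U′) `F1Sign2.OddBranchShaIndexTwoInTwistSelmerAtTwo` HOLDS, unconditionally.** On the odd branch (`Δ > 0`, `E(ℚ)[2] = 0`,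
rank `0`, `#Sel₂(W) = 4`, every admissible twist with `#Sel₂(W^{(d)}) = 8`), for every descent-admissible `d` with character `χ`:
`Sel₂(W) = Ш(W)[2] ≤ Sel_𝔓(A_χ/ℚ)` with index `2`. Proof: `#Sel_𝔓(A_χ) = #Sel₂(W^{(d)}) = 8` (the dictionary, §178) `= 2·#Sel₂(W)`, so
`Sel_𝔓(A_χ) = Sel₂^{rel ∞}(W)` (DESC-§17-R `twistSelmerEqRelaxedAtInfinityAtTwo_holds`), whose index over `Sel₂(W)` is `8/4 = 2`
(`natCard_selmerGroupRelaxedAtInfinityAtTwo_eq_mul`); `F1Sign2.shaIndexTwo_of_relaxed` assembles. Known in print (MR 2010 §3 / Kramer 1981);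
kernel-new; BSD is not proved by this. [cite: MazurRubin2010, Lemma 3.2 and Prop 3.3] [cite: MazurRubin2007, §3 and Def 4.3] [cite: Kramer1981, Thm. 1] -/
theorem oddBranchShaIndexTwoInTwistSelmerAtTwo_holds : OddBranchShaIndexTwoInTwistSelmerAtTwo := by
  intro W _ _ hodd d χ hd hχ
  obtain ⟨_, _, _, hS4, htw⟩ := hodd
  have hd0 : d ≠ 0 := hd.1.ne
  have hP8 : Nat.card (PrimeTwist.selmerGroup W χ) = 8 := by
    rw [natCard_primeTwist_selmerGroup_eq_twistSelmerTwoCard W hd0 hχ, htw d hd]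
  have hR : PrimeTwist.selmerGroup W χ = selmerGroupRelaxedAtInfinityAtTwo W :=
    (twistSelmerEqRelaxedAtInfinityAtTwo_holds W d χ hd hχ).2 (by rw [hP8, hS4])
  have hR8 : Nat.card (selmerGroupRelaxedAtInfinityAtTwo W) = 8 := by rw [← hR]; exact hP8
  have hidx : (W.selmerGroup ((2 : ℕ) : ℤ)).relIndex (selmerGroupRelaxedAtInfinityAtTwo W) = 2 := by
    have h := natCard_selmerGroupRelaxedAtInfinityAtTwo_eq_mul W
    rw [hR8, hS4] at h
    omega
  exact shaIndexTwo_of_relaxed W χ hR (selmerGroup_le_selmerGroupRelaxedAtInfinityAtTwo W) hidx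

/-- **DESC-A∞ from DESC-A alone**: with U′ proved, the glue `F1Sign2.radicalRealParityLaw_of_sumLaw` makes the real-parity law
`OddBranchCasselsTateRadicalRealParityLawAtTwo` a consequence of the sum law `OddBranchCasselsTateRadicalSumLawAtTwo` only (the latter — Morgan 2023
Prop. 19 / Morgan–Smith trilinearity — is NOT proved here). [cite: Morgan2023KummerGeneric, Prop 19] [cite: MazurRubin2010, Lemma 3.2] -/
theorem oddBranchCasselsTateRadicalRealParityLawAtTwo_of_sumLaw (hA : OddBranchCasselsTateRadicalSumLawAtTwo) :
    OddBranchCasselsTateRadicalRealParityLawAtTwo :=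
  radicalRealParityLaw_of_sumLaw hA oddBranchShaIndexTwoInTwistSelmerAtTwo_holds

/-! ## §180 The UP decision off the egg, in prime-twist currency -/

section Up

variable (W : WeierstrassCurve ℚ) [W.IsElliptic] [W.IsGloballyMinimal] {d : ℤ} {χ : absoluteGaloisGroup ℚ →ₜ* Multiplicative (ZMod 2)}

/-- **THE UP DECISION.** `Δ_W > 0`, `E(ℚ)[2] = 0`, `d` descent-admissible with character `χ`, and every `2`-Selmer class of `W` trivial at `∞`
(Selmer egg bit `0`) ⟹ `Sel_𝔓(A_χ/ℚ) = Sel₂^{rel ∞}(W)` and `#Sel_𝔓(A_χ) = 2·#Sel₂(W)`. Proof: file 38's dichotomy gives `#Sel_𝔓 ∈ {#Sel₂, 2·#Sel₂}`,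
T-A (`admissibleTwistSelmerShiftAtTwo_holds`, model currency) gives `#Sel₂(W^{(d)}) ∈ {#Sel₂/2, 2·#Sel₂}`, the dictionary identifies the two
counts, and `#Sel₂(W) ≠ 0` (finite); DESC-§17-R turns the count into the equality. This is Kramer's parity / Mazur–Rubin Prop. 3.3 at the real
place in prime-twist currency. [cite: Kramer1981, Thm. 1 and Prop. 7] [cite: MazurRubin2010, Lemma 3.2 and Prop 3.3] [cite: MazurRubin2007, §3 and Def 4.3] -/
theorem primeTwist_selmerGroup_eq_relaxed_of_forall_localization_eq_zero (hΔ : 0 < W.Δ) (hT : NoRationalTwoTorsion W)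
    (hd : DescAdmissible W d) (hχ : IsQuadraticCharacterOf χ d) (w : InfinitePlace ℚ)
    (hall : ∀ c ∈ W.selmerGroup ((2 : ℕ) : ℤ),
      galoisCohomology.localization (W.torsionGaloisModule ((2 : ℕ) : ℤ)) (Sum.inl w) 1 c = 0) :
    PrimeTwist.selmerGroup W χ = selmerGroupRelaxedAtInfinityAtTwo W ∧
      Nat.card (PrimeTwist.selmerGroup W χ) = 2 * selmerTwoCard W := by
  have hd0 : d ≠ 0 := hd.1.ne
  haveI : Finite (W.selmerGroup ((2 : ℕ) : ℤ)) := W.finite_selmerGroup_holds (by norm_num)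
  have hS0 : selmerTwoCard W ≠ 0 := by
    change Nat.card (W.selmerGroup ((2 : ℕ) : ℤ)) ≠ 0
    exact Nat.card_pos.ne'
  have hdict : twistSelmerTwoCard W d = Nat.card (PrimeTwist.selmerGroup W χ) :=
    (natCard_primeTwist_selmerGroup_eq_twistSelmerTwoCard W hd0 hχ).symm
  have hTA := admissibleTwistSelmerShiftAtTwo_holds W hΔ hT d hd
  rw [hdict] at hTA
  have hcount : Nat.card (PrimeTwist.selmerGroup W χ) = 2 * selmerTwoCard W := by
    rcases (primeTwist_selmerGroup_eq_or_eq_of_forall_localization_eq_zero W hΔ hd hχ w hall).2 with h | h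
    · exfalso
      rw [h] at hTA
      rcases hTA with h' | h' <;> omega
    · exact h
  exact ⟨(twistSelmerEqRelaxedAtInfinityAtTwo_holds W d χ hd hχ).2 hcount, hcount⟩

/-- **The prime-twist Selmer law by the `∞`-bit of `Sel₂(W)`** (`Δ_W > 0`, `E(ℚ)[2] = 0`, `d` descent-admissible, `χ` its character):
if every `Sel₂(W)`-class is trivial at `∞` then `#Sel_𝔓(A_χ) = 2·#Sel₂(W)` (UP, §180), otherwise `2·#Sel_𝔓(A_χ) = #Sel₂(W)` (DOWN, file 38
`two_mul_natCard_primeTwist_selmerGroup_eq_of_relaxed_le_selmerGroup` via `Sel₂ = Sel₂^{rel ∞}`). T-A `AdmissibleTwistSelmerShiftAtTwo` in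
prime-twist currency with the branch DECIDED. [cite: Kramer1981, Thm. 1, Prop. 6 and Prop. 7] [cite: MazurRubin2010, Lemma 3.2, Prop 3.3, Cor 3.4] -/
theorem natCard_primeTwist_selmerGroup_eq_of_infinity_bit (hΔ : 0 < W.Δ) (hT : NoRationalTwoTorsion W)
    (hd : DescAdmissible W d) (hχ : IsQuadraticCharacterOf χ d) (w : InfinitePlace ℚ) :
    ((∀ c ∈ W.selmerGroup ((2 : ℕ) : ℤ),
        galoisCohomology.localization (W.torsionGaloisModule ((2 : ℕ) : ℤ)) (Sum.inl w) 1 c = 0) →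
      Nat.card (PrimeTwist.selmerGroup W χ) = 2 * selmerTwoCard W) ∧
    ((∃ c ∈ W.selmerGroup ((2 : ℕ) : ℤ),
        galoisCohomology.localization (W.torsionGaloisModule ((2 : ℕ) : ℤ)) (Sum.inl w) 1 c ≠ 0) →
      2 * Nat.card (PrimeTwist.selmerGroup W χ) = selmerTwoCard W) := by
  refine ⟨fun hall ↦ (primeTwist_selmerGroup_eq_relaxed_of_forall_localization_eq_zero W hΔ hT hd hχ w hall).2, fun hex ↦ ?_⟩
  apply two_mul_natCard_primeTwist_selmerGroup_eq_of_relaxed_le_selmerGroup W hΔ hd hχ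
  -- a class non-trivial at `∞` forces `Sel₂(W) = Sel₂^{rel ∞}(W)` (index `1`, file 16/17)
  rcases selmerGroup_eq_kummerStrict_or_eq_relaxed_of_Δ_pos W hΔ w with h | h
  · exfalso
    obtain ⟨c, hc, hne⟩ := hex
    rw [h] at hc
    exact hne ((mem_selmerGroup_kummerStrict_singleton_inl_iff W w c).mp hc).2
  · exact h.symm.le

end Up

end Summit.BirchSwinnertonDyer.BirchSwinnertonDyer.Theorems.GenusKolyArch

end
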